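import Summits.QuantumFields.BalabanUV.Beta.GAN24.CombTransportedBorder
import Summits.QuantumFields.BalabanUV.Beta.GAN24.TwoFaceWordAdditive
import Summits.QuantumFields.BalabanUV.Beta.GAN24.SlotTransportParity

/-!
# `BalabanUV.Beta.GAN24.CombForcingSectorSplit` — binder row G-an2-4 ∕ (CONV-C), TRANSFER-III, the (III′) (C)-campaign's supplier `hB0` (memo M-1 §2 row `hB0`, VALUE side):
# **29∕30's SECTOR SPLIT AT THE COMB DATA — the background derivative of the bm kernel on the TRANSPORTED comb running table splits as `V^E′ + (V^VH′ + V^M)`**, the transport being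
# linear and commuting with the units: at level `j+1` the sectors are `𝒯((cE·wE)•e3OfK Lc G_j (𝒯 S̃_j))` (road-P2 M.43's reading of an2's `SpureCombOf_succ`) and `𝒯((cVH·wVH)•tabs.V)`,
# at level `0` they are `𝒯(cE•wilsonA)` and `𝒯(cVH•tabs.V)`; the three half-vertex families are block-covariant vertex families (the sockets of leaf-04's 23∕24∕26∕27 and of 30's
# generic `tsum_direct_word_split ∕ tsum_swap_word_split`)
# (G-an2-4 CRUX TEAM (2), leaf prover `b2b-balaban-gan24-formalise-leaf-01`, gen 85; journal [LEAF01-G85-INTENT-6])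

NOT IN PRINT; OUR BOOKKEEPING ([folklore] linearity bookkeeping BY NAME: leaf-02's `slotPsiS_add ∕ slotPsiS_smul`, an5's tame bilinearity of `comp`, leaf-01 g85's `CombTransportedBorder.transport_unitS`,
leaf-04's 29 `TwoFaceWordAdditive.dM_unitS_add`, road-P2 M.43 `SpureCombOf_succ_eq_bm_transport ∕ locStencil_transportPsiS`, an2's `vertexFamily_vertexOfK ∕ vertexOfK_translate`; 0 `def`,
0 cited fact, 0 `def … : Prop`, 0 sorry).
HONEST FRAMING (cell contract, verbatim): «discharging `BetaPertH` makes Bałaban's UV stability UNCONDITIONAL — a real constructive-QFT result; it is NOT the continuum limit and NOT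
the Clay problem.»  HONEST DEPENDENCY (verbatim): «continuum YM on T⁴ ⇐ BetaPertH ∧ nine spine estimates (0/9 proved); BetaPertH ⇐ (D1) ∧ (D4) ∧ CAP+tail; G-an2-4 gates asym, D1
and NE2/3/4.»

## What is proved (generic `d`; `𝒯S κ u := Ψ̂ᵀ ∘ slotPsiS r n S κ u ∘ Ψ̂`; at the comb data `Ψ̂ = Ψ̂_S = psiKS (ctrOff (d+1) Lc) Lc`, `ρ_c = ctr (d+1) Lc`, `G_j = coDressKBmAt ρ_c Lc (KInvStep Lc j)`,
## `X̃_i = unitK s_f s_m (G_i)`, `S̃′_i = unitS s_f s_m (SpureCombOf tabs cE cVH cΛ i)`)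
* §1 (generic `0 < n`, `r ∈ box`) **`transport_add`**, **`transport_smul`** — `𝒯` is linear on local stencil families (as families).
* §2 THE TRANSPORTED PURE TABLE SPLITS (any `tabs`): **`transport_SpureCombOf_succ`** (`𝒯 (SpureCombOf … (j+1)) = 𝒯((cE·wE (j+1)) • e3OfK Lc G_j (𝒯 (ScombOf … j))) + 𝒯((cVH·wVH (j+1)) • tabs.V)`),
  **`transport_SpureCombOf_zero`** (`𝒯 (SpureCombOf … 0) = 𝒯(cE • wilsonA) + 𝒯(cVH • tabs.V)`), and with units **`transportS_succ_eq_unitS_add`** ∕ **`transportS_zero_eq_unitS_add`**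
  (`𝒯 S̃′ = unitS s_f s_m (E′ + VH′)`).
* §3 **`dM_comb_succ_split`** ∕ **`dM_comb_zero_split`**: `dM X̃ Lc (𝒯 S̃′) M b = V^E′_b + (V^VH′_b + V^M_b)` with `V^E′ := vertexOfK X̃ Lc (unitS s_f s_m E′)`, `V^VH′ := vertexOfK X̃ Lc (unitS s_f s_m VH′)`,
  `V^M := vertexOfM X̃ Lc M` — 29's `dM_unitS_add` (the kernel `X̃_i` of level `i`; any multiplier table `M`).
* §4 sockets of the sectors: `exists_locStencil_E_succ ∕ _E_zero ∕ _VH` (local stencil families), `E_succ_translate ∕ E_zero_translate ∕ VH_translate` (block covariance).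
WHAT THIS IS NOT: no word is evaluated or killed here (23 ∕ F3 ∕ F4 ∕ F5 and the open `E ⊗ VH`, `E ⊗ E` words are the consumers); NO value; NOT `hB0`; the (III′) campaign is NOT asked (an2 W-4);
NEVER «G-an2-4 closed» as (CONV-C); NOT D1, NOT `BetaPertH`, NOT continuum, NOT Clay.  2026-08-27; no existing file touched.
-/

noncomputable section

open Finset
open scoped BigOperators
open Literature.MathematicalPhysics.QuantumFieldTheory
open Literature.MathematicalPhysics.QuantumFieldTheory.Balaban1983to89
open Literature.MathematicalPhysics.QuantumFieldTheory.Balaban1983to89.Beta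
open ExpKernelCalculus (Site MKer comp shiftK Decays BiLoc VertexFamily)
open AffineAveraging (box toSite)
open AveragingContoursRooted (ctr ctrOff ctrOff_mem_box)
open OneStepResolventKernel (Fib LocStencil biLoc_mono)
open OneStepKernelFamily (KInvStep vertexOfK vertexFamily_vertexOfK)
open SecondOrderResponse (dM vertexOfM)
open StepJetData (wilsonA locStencil_wilsonA wilsonA_translate locStencil_smul)
open BalabanStepJetsSucc (wE wVH)
open Summit.QuantumFields.BalabanUV.Beta.TameKernelCalculus
open Summit.QuantumFields.BalabanUV.Beta.HessKerDressedUnits (unitK unitS decays_unitK locStencil_unitS)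
open Summit.QuantumFields.BalabanUV.Beta.AxialDressingRooted (coDressKBmAt decays_coDressKBmAt_KInvStep)
open Summit.QuantumFields.BalabanUV.Beta.SpineRooted (e3OfK)
open Summit.QuantumFields.BalabanUV.Beta.SymmetrisedStepJets (SymTables)
open Summit.QuantumFields.BalabanUV.Beta.CombChartStepJets (ScombOf SpureCombOf SpureCombOf_eq locStencil_ScombOf locStencil_SpureCombOf)
open Summit.QuantumFields.BalabanUV.Beta.SymCorrectorKernel (psiKS spr_psiKS)
open Summit.QuantumFields.BalabanUV.Beta.SymCorrectorFace (slotPsiS)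
open Summit.QuantumFields.BalabanUV.Beta.SymCorrectorSockets (locStencil_slotPsiS)
open Summit.QuantumFields.BalabanUV.Beta.GAN24.SlotTransportParity (slotPsiS_add slotPsiS_smul)
open Summit.QuantumFields.BalabanUV.Beta.GAN24.CombCubicStepTransport (locStencil_transportPsiS SpureCombOf_succ_eq_bm_transport)
open Summit.QuantumFields.BalabanUV.Beta.GAN24.CombTransportedBorder (transport_unitS pos_Lc)
open Summit.QuantumFields.BalabanUV.Beta.GAN24.TwoFaceWordAdditive (dM_unitS_add)

namespace Summit.QuantumFields.BalabanUV.Beta.GAN24.CombForcingSectorSplit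

variable {d : ℕ}

/-! ## §1 The transport is linear on local stencil families -/

section Linear

variable {n : ℕ} (hn : 0 < n) {r : Fin (d + 1) → ℕ} (hr : r ∈ box (d + 1) n)
include hn hr

/-- [folklore] **`𝒯 (S + T) = 𝒯 S + 𝒯 T`** for local stencil families (`slotPsiS_add`; tame bilinearity of the two leg compositions). -/
theorem transport_add {S T : Fin (d + 1) → Site (d + 1) → MKer (d + 1) (Fib d)} {Cs δs Ct δt : ℝ} (hS : LocStencil S Cs δs) (hδs : 0 < δs) (hT : LocStencil T Ct δt) (hδt : 0 < δt) :
    (fun κ u => comp (comp (trK (psiKS r n)) (slotPsiS r n (fun κ u => S κ u + T κ u) κ u)) (psiKS r n))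
      = fun κ u => comp (comp (trK (psiKS r n)) (slotPsiS r n S κ u)) (psiKS r n) + comp (comp (trK (psiKS r n)) (slotPsiS r n T κ u)) (psiKS r n) := by
  have hΨ : Spr (psiKS r n) := spr_psiKS hn hr
  have hSΨ := locStencil_slotPsiS (d := d) hn r hS hδs.le
  have hTΨ := locStencil_slotPsiS (d := d) hn r hT hδt.le
  funext κ u
  have eST : (fun κ u => S κ u + T κ u) = S + T := rfl
  have hA : Loc (slotPsiS r n S κ u) := ⟨u, u, _, _, hδs, hSΨ κ u⟩
  have hB : Loc (slotPsiS r n T κ u) := ⟨u, u, _, _, hδt, hTΨ κ u⟩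
  rw [eST, slotPsiS_add, Pi.add_apply, Pi.add_apply, comp_add_right_tame hΨ.trK.tame hA.tame hB.tame,
    comp_add_left_tame (hΨ.trK.comp_loc hA).tame (hΨ.trK.comp_loc hB).tame hΨ.tame]

omit hn hr in
/-- [folklore] **`𝒯 (c • S) = c • 𝒯 S`** (as families; `slotPsiS_smul`, `comp_smul_right ∕ left`). -/
theorem transport_smul (c : ℝ) (S : Fin (d + 1) → Site (d + 1) → MKer (d + 1) (Fib d)) :
    (fun κ u => comp (comp (trK (psiKS r n)) (slotPsiS r n (fun κ u => c • S κ u) κ u)) (psiKS r n))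
      = fun κ u => c • comp (comp (trK (psiKS r n)) (slotPsiS r n S κ u)) (psiKS r n) := by
  funext κ u
  have eS : (fun κ u => c • S κ u) = c • S := rfl
  rw [eS, slotPsiS_smul, Pi.smul_apply, Pi.smul_apply, KernelReflection.comp_smul_right, KernelReflection.comp_smul_left]

end Linear

/-! ## §2 The transported pure comb table splits into its sectors -/

section Comb

variable {Lc : ℕ} [NeZero Lc]

/-- [folklore] The E-sector raw table at level `j+1`: `e3OfK Lc G_j (𝒯 (ScombOf tabs … j))` is a local stencil family (an2's `locStencil_ScombOf` ⨾ M.43 `locStencil_transportPsiS` ⨾ an2's `locStencil_e3OfK`). -/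
theorem exists_locStencil_e3Sector_comb (tabs : SymTables d Lc) (cE cVH cΛ : ℝ) (j : ℕ) :
    ∃ C δ : ℝ, 0 < δ ∧ LocStencil (e3OfK Lc (coDressKBmAt (ctr (d + 1) Lc) Lc (KInvStep (d := d) Lc j))
      (fun κ u => comp (comp (trK (psiKS (ctrOff (d + 1) Lc) Lc)) (slotPsiS (ctrOff (d + 1) Lc) Lc (ScombOf tabs cE cVH cΛ j) κ u)) (psiKS (ctrOff (d + 1) Lc) Lc))) C δ := by
  obtain ⟨Cs, δs, hδs, hS⟩ := locStencil_ScombOf tabs cE cVH cΛ j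
  obtain ⟨C', δ', hδ', hT⟩ := locStencil_transportPsiS (pos_Lc (Lc := Lc)) (ctrOff_mem_box (pos_Lc (Lc := Lc))) hS hδs
  obtain ⟨δ, C, hδ, -, hG⟩ := decays_coDressKBmAt_KInvStep (d := d) (Lc := Lc) (ctrOff_mem_box (pos_Lc (Lc := Lc))) j
  exact SpineRooted.locStencil_e3OfK (Nat.one_le_iff_ne_zero.mpr (NeZero.ne Lc)) ⟨δ, C, hδ, hG.nonneg (Sum.inl 0), hG⟩ hT hδ'

/-- [folklore] **THE TRANSPORTED PURE COMB TABLE AT LEVEL `j+1` IS THE SUM OF ITS TRANSPORTED SECTORS**: `𝒯 (SpureCombOf … (j+1)) = 𝒯((cE·wE) • e3OfK Lc G_j (𝒯 (ScombOf … j))) + 𝒯((cVH·wVH) • tabs.V)`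
(M.43's `SpureCombOf_succ_eq_bm_transport` ⨾ §1 `transport_add`). -/
theorem transport_SpureCombOf_succ (tabs : SymTables d Lc) (cE cVH cΛ : ℝ) (j : ℕ) :
    (fun κ u => comp (comp (trK (psiKS (ctrOff (d + 1) Lc) Lc)) (slotPsiS (ctrOff (d + 1) Lc) Lc (SpureCombOf tabs cE cVH cΛ (j + 1)) κ u)) (psiKS (ctrOff (d + 1) Lc) Lc))
      = fun κ u =>
        comp (comp (trK (psiKS (ctrOff (d + 1) Lc) Lc)) (slotPsiS (ctrOff (d + 1) Lc) Lc
          (fun κ u => (cE * wE d Lc (j + 1)) • e3OfK Lc (coDressKBmAt (ctr (d + 1) Lc) Lc (KInvStep (d := d) Lc j))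
            (fun κ u => comp (comp (trK (psiKS (ctrOff (d + 1) Lc) Lc)) (slotPsiS (ctrOff (d + 1) Lc) Lc (ScombOf tabs cE cVH cΛ j) κ u)) (psiKS (ctrOff (d + 1) Lc) Lc)) κ u) κ u))
          (psiKS (ctrOff (d + 1) Lc) Lc)
        + comp (comp (trK (psiKS (ctrOff (d + 1) Lc) Lc)) (slotPsiS (ctrOff (d + 1) Lc) Lc (fun κ u => (cVH * wVH d Lc (j + 1)) • tabs.V κ u) κ u)) (psiKS (ctrOff (d + 1) Lc) Lc) := by
  obtain ⟨CE, δE, hδE, hE⟩ := exists_locStencil_e3Sector_comb (d := d) (Lc := Lc) tabs cE cVH cΛ j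
  obtain ⟨CV, hV⟩ := tabs.hV 1 zero_le_one
  rw [SpureCombOf_succ_eq_bm_transport tabs cE cVH cΛ j]
  exact transport_add (pos_Lc (Lc := Lc)) (ctrOff_mem_box (pos_Lc (Lc := Lc))) (locStencil_smul (cE * wE d Lc (j + 1)) hE) hδE (locStencil_smul (cVH * wVH d Lc (j + 1)) hV) one_pos

/-- [folklore] **… AND AT LEVEL `0`**: `𝒯 (SpureCombOf … 0) = 𝒯(cE • wilsonA) + 𝒯(cVH • tabs.V)` (an2's `SpureRecOf_zero_level` ⨾ §1). -/
theorem transport_SpureCombOf_zero (tabs : SymTables d Lc) (cE cVH cΛ : ℝ) :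
    (fun κ u => comp (comp (trK (psiKS (ctrOff (d + 1) Lc) Lc)) (slotPsiS (ctrOff (d + 1) Lc) Lc (SpureCombOf tabs cE cVH cΛ 0) κ u)) (psiKS (ctrOff (d + 1) Lc) Lc))
      = fun κ u =>
        comp (comp (trK (psiKS (ctrOff (d + 1) Lc) Lc)) (slotPsiS (ctrOff (d + 1) Lc) Lc (fun κ u => cE • wilsonA d κ u) κ u)) (psiKS (ctrOff (d + 1) Lc) Lc)
        + comp (comp (trK (psiKS (ctrOff (d + 1) Lc) Lc)) (slotPsiS (ctrOff (d + 1) Lc) Lc (fun κ u => cVH • tabs.V κ u) κ u)) (psiKS (ctrOff (d + 1) Lc) Lc) := by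
  obtain ⟨CV, hV⟩ := tabs.hV 1 zero_le_one
  rw [SpureCombOf_eq, SpineRooted.SpureRecOf_zero_level]
  exact transport_add (pos_Lc (Lc := Lc)) (ctrOff_mem_box (pos_Lc (Lc := Lc))) (locStencil_smul cE (locStencil_wilsonA (d := d) zero_le_one)) one_pos (locStencil_smul cVH hV) one_pos

/-! ## §3 The background derivative on the transported comb running table splits into three half-vertex families -/

/-- NOT IN PRINT; OUR BOOKKEEPING ([folklore]; 29∕30's SECTOR SPLIT AT THE COMB DATA, LEVEL `j+1`).  For ANY `tabs`, units, pins, ANY kernel `K` decaying at a positive rate and ANY multiplier table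
`M`, every bond: `dM K Lc (𝒯 S̃′_{j+1}) M b = V^E′_b + (V^VH′_b + V^M_b)` with `𝒯 S̃′_{j+1} = 𝒯 (unitS s_f s_m (SpureCombOf … (j+1)))`, `V^E′ := vertexOfK K Lc (unitS s_f s_m (𝒯((cE·wE)•e3OfK Lc G_j (𝒯 ScombOf_j))))`,
`V^VH′ := vertexOfK K Lc (unitS s_f s_m (𝒯((cVH·wVH)•tabs.V)))`, `V^M := vertexOfM K Lc M` (leaf-01 g85's `transport_unitS` ⨾ §2 ⨾ leaf-04's 29 `dM_unitS_add`). -/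
theorem dM_comb_succ_split (tabs : SymTables d Lc) (sf sm cE cVH cΛ : ℝ) (j : ℕ) {K : MKer (d + 1) (Fib d)} {CK δK : ℝ} (hK : Decays K CK δK) (hδK : 0 < δK)
    (M : Fin (d + 1) → Site (d + 1) → MKer (d + 1) (Fib d)) (μ : Fin (d + 1)) (y : Site (d + 1)) :
    dM K Lc (fun κ u => comp (comp (trK (psiKS (ctrOff (d + 1) Lc) Lc)) (slotPsiS (ctrOff (d + 1) Lc) Lc (unitS sf sm (SpureCombOf tabs cE cVH cΛ (j + 1))) κ u)) (psiKS (ctrOff (d + 1) Lc) Lc)) M μ y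
      = vertexOfK K Lc (unitS sf sm (fun κ u => comp (comp (trK (psiKS (ctrOff (d + 1) Lc) Lc)) (slotPsiS (ctrOff (d + 1) Lc) Lc
            (fun κ u => (cE * wE d Lc (j + 1)) • e3OfK Lc (coDressKBmAt (ctr (d + 1) Lc) Lc (KInvStep (d := d) Lc j))
              (fun κ u => comp (comp (trK (psiKS (ctrOff (d + 1) Lc) Lc)) (slotPsiS (ctrOff (d + 1) Lc) Lc (ScombOf tabs cE cVH cΛ j) κ u)) (psiKS (ctrOff (d + 1) Lc) Lc)) κ u) κ u))
            (psiKS (ctrOff (d + 1) Lc) Lc))) μ y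
        + (vertexOfK K Lc (unitS sf sm (fun κ u => comp (comp (trK (psiKS (ctrOff (d + 1) Lc) Lc)) (slotPsiS (ctrOff (d + 1) Lc) Lc (fun κ u => (cVH * wVH d Lc (j + 1)) • tabs.V κ u) κ u))
            (psiKS (ctrOff (d + 1) Lc) Lc))) μ y
          + vertexOfM K Lc M μ y) := by
  obtain ⟨CE, δE, hδE, hE⟩ := exists_locStencil_e3Sector_comb (d := d) (Lc := Lc) tabs cE cVH cΛ j
  obtain ⟨CV, hV⟩ := tabs.hV 1 zero_le_one
  obtain ⟨C₁, δ₁, hδ₁, hT₁⟩ := locStencil_transportPsiS (pos_Lc (Lc := Lc)) (ctrOff_mem_box (pos_Lc (Lc := Lc))) (locStencil_smul (cE * wE d Lc (j + 1)) hE) hδE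
  obtain ⟨C₂, δ₂, hδ₂, hT₂⟩ := locStencil_transportPsiS (pos_Lc (Lc := Lc)) (ctrOff_mem_box (pos_Lc (Lc := Lc))) (locStencil_smul (cVH * wVH d Lc (j + 1)) hV) one_pos
  rw [transport_unitS (ctrOff (d + 1) Lc) Lc sf sm, transport_SpureCombOf_succ tabs cE cVH cΛ j]
  have e : (fun κ u =>
        comp (comp (trK (psiKS (ctrOff (d + 1) Lc) Lc)) (slotPsiS (ctrOff (d + 1) Lc) Lc
          (fun κ u => (cE * wE d Lc (j + 1)) • e3OfK Lc (coDressKBmAt (ctr (d + 1) Lc) Lc (KInvStep (d := d) Lc j))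
            (fun κ u => comp (comp (trK (psiKS (ctrOff (d + 1) Lc) Lc)) (slotPsiS (ctrOff (d + 1) Lc) Lc (ScombOf tabs cE cVH cΛ j) κ u)) (psiKS (ctrOff (d + 1) Lc) Lc)) κ u) κ u))
          (psiKS (ctrOff (d + 1) Lc) Lc)
        + comp (comp (trK (psiKS (ctrOff (d + 1) Lc) Lc)) (slotPsiS (ctrOff (d + 1) Lc) Lc (fun κ u => (cVH * wVH d Lc (j + 1)) • tabs.V κ u) κ u)) (psiKS (ctrOff (d + 1) Lc) Lc))
      = fun κ u =>
        (fun κ u => comp (comp (trK (psiKS (ctrOff (d + 1) Lc) Lc)) (slotPsiS (ctrOff (d + 1) Lc) Lc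
          (fun κ u => (cE * wE d Lc (j + 1)) • e3OfK Lc (coDressKBmAt (ctr (d + 1) Lc) Lc (KInvStep (d := d) Lc j))
            (fun κ u => comp (comp (trK (psiKS (ctrOff (d + 1) Lc) Lc)) (slotPsiS (ctrOff (d + 1) Lc) Lc (ScombOf tabs cE cVH cΛ j) κ u)) (psiKS (ctrOff (d + 1) Lc) Lc)) κ u) κ u))
          (psiKS (ctrOff (d + 1) Lc) Lc)) κ u
        + (fun κ u => comp (comp (trK (psiKS (ctrOff (d + 1) Lc) Lc)) (slotPsiS (ctrOff (d + 1) Lc) Lc (fun κ u => (cVH * wVH d Lc (j + 1)) • tabs.V κ u) κ u)) (psiKS (ctrOff (d + 1) Lc) Lc)) κ u := rfl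
  rw [e, dM_unitS_add (N := Lc) hK hδK sf sm hT₁ hδ₁.le hT₂ hδ₂.le M μ y]
  rfl

/-- NOT IN PRINT; OUR BOOKKEEPING ([folklore]; THE SAME AT LEVEL `0`): `dM K Lc (𝒯 S̃′_0) M b = V^{E,0}′_b + (V^VH′_b + V^M_b)` with `V^{E,0}′ := vertexOfK K Lc (unitS s_f s_m (𝒯(cE • wilsonA)))`,
`V^VH′ := vertexOfK K Lc (unitS s_f s_m (𝒯(cVH • tabs.V)))`. -/
theorem dM_comb_zero_split (tabs : SymTables d Lc) (sf sm cE cVH cΛ : ℝ) {K : MKer (d + 1) (Fib d)} {CK δK : ℝ} (hK : Decays K CK δK) (hδK : 0 < δK)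
    (M : Fin (d + 1) → Site (d + 1) → MKer (d + 1) (Fib d)) (μ : Fin (d + 1)) (y : Site (d + 1)) :
    dM K Lc (fun κ u => comp (comp (trK (psiKS (ctrOff (d + 1) Lc) Lc)) (slotPsiS (ctrOff (d + 1) Lc) Lc (unitS sf sm (SpureCombOf tabs cE cVH cΛ 0)) κ u)) (psiKS (ctrOff (d + 1) Lc) Lc)) M μ y
      = vertexOfK K Lc (unitS sf sm (fun κ u => comp (comp (trK (psiKS (ctrOff (d + 1) Lc) Lc)) (slotPsiS (ctrOff (d + 1) Lc) Lc (fun κ u => cE • wilsonA d κ u) κ u)) (psiKS (ctrOff (d + 1) Lc) Lc))) μ y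
        + (vertexOfK K Lc (unitS sf sm (fun κ u => comp (comp (trK (psiKS (ctrOff (d + 1) Lc) Lc)) (slotPsiS (ctrOff (d + 1) Lc) Lc (fun κ u => cVH • tabs.V κ u) κ u)) (psiKS (ctrOff (d + 1) Lc) Lc))) μ y
          + vertexOfM K Lc M μ y) := by
  obtain ⟨CV, hV⟩ := tabs.hV 1 zero_le_one
  obtain ⟨C₁, δ₁, hδ₁, hT₁⟩ := locStencil_transportPsiS (pos_Lc (Lc := Lc)) (ctrOff_mem_box (pos_Lc (Lc := Lc))) (locStencil_smul cE (locStencil_wilsonA (d := d) zero_le_one)) one_pos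
  obtain ⟨C₂, δ₂, hδ₂, hT₂⟩ := locStencil_transportPsiS (pos_Lc (Lc := Lc)) (ctrOff_mem_box (pos_Lc (Lc := Lc))) (locStencil_smul cVH hV) one_pos
  rw [transport_unitS (ctrOff (d + 1) Lc) Lc sf sm, transport_SpureCombOf_zero tabs cE cVH cΛ]
  have e : (fun κ u =>
        comp (comp (trK (psiKS (ctrOff (d + 1) Lc) Lc)) (slotPsiS (ctrOff (d + 1) Lc) Lc (fun κ u => cE • wilsonA d κ u) κ u)) (psiKS (ctrOff (d + 1) Lc) Lc)
        + comp (comp (trK (psiKS (ctrOff (d + 1) Lc) Lc)) (slotPsiS (ctrOff (d + 1) Lc) Lc (fun κ u => cVH • tabs.V κ u) κ u)) (psiKS (ctrOff (d + 1) Lc) Lc))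
      = fun κ u =>
        (fun κ u => comp (comp (trK (psiKS (ctrOff (d + 1) Lc) Lc)) (slotPsiS (ctrOff (d + 1) Lc) Lc (fun κ u => cE • wilsonA d κ u) κ u)) (psiKS (ctrOff (d + 1) Lc) Lc)) κ u
        + (fun κ u => comp (comp (trK (psiKS (ctrOff (d + 1) Lc) Lc)) (slotPsiS (ctrOff (d + 1) Lc) Lc (fun κ u => cVH • tabs.V κ u) κ u)) (psiKS (ctrOff (d + 1) Lc) Lc)) κ u := rfl
  rw [e, dM_unitS_add (N := Lc) hK hδK sf sm hT₁ hδ₁.le hT₂ hδ₂.le M μ y]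
  rfl

/-! ## §4 Sockets of the two transported field sectors: local, block-covariant, hence vertex families with block-covariant half-vertices -/

/-- [folklore] **THE E-SECTOR RAW TABLE AT LEVEL `j+1` IS BLOCK-COVARIANT** (an2's `ScombOf_translate` through the transport, then an2's `e3OfK_translate`; the colour weight rides along). -/
theorem E_succ_translate (tabs : SymTables d Lc) (cE cVH cΛ : ℝ) (j : ℕ) (κ : Fin (d + 1)) (u t : Site (d + 1)) :
    (fun κ u => (cE * wE d Lc (j + 1)) • e3OfK Lc (coDressKBmAt (ctr (d + 1) Lc) Lc (KInvStep (d := d) Lc j))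
        (fun κ u => comp (comp (trK (psiKS (ctrOff (d + 1) Lc) Lc)) (slotPsiS (ctrOff (d + 1) Lc) Lc (ScombOf tabs cE cVH cΛ j) κ u)) (psiKS (ctrOff (d + 1) Lc) Lc)) κ u) κ (u + (Lc : ℤ) • t)
      = shiftK (-((Lc : ℤ) • t)) ((fun κ u => (cE * wE d Lc (j + 1)) • e3OfK Lc (coDressKBmAt (ctr (d + 1) Lc) Lc (KInvStep (d := d) Lc j))
        (fun κ u => comp (comp (trK (psiKS (ctrOff (d + 1) Lc) Lc)) (slotPsiS (ctrOff (d + 1) Lc) Lc (ScombOf tabs cE cVH cΛ j) κ u)) (psiKS (ctrOff (d + 1) Lc) Lc)) κ u) κ u) := by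
  have hS : ∀ (κ : Fin (d + 1)) (u t : Site (d + 1)),
      (fun κ u => comp (comp (trK (psiKS (ctrOff (d + 1) Lc) Lc)) (slotPsiS (ctrOff (d + 1) Lc) Lc (ScombOf tabs cE cVH cΛ j) κ u)) (psiKS (ctrOff (d + 1) Lc) Lc)) κ (u + (Lc : ℤ) • t)
        = shiftK (-((Lc : ℤ) • t)) ((fun κ u => comp (comp (trK (psiKS (ctrOff (d + 1) Lc) Lc)) (slotPsiS (ctrOff (d + 1) Lc) Lc (ScombOf tabs cE cVH cΛ j) κ u)) (psiKS (ctrOff (d + 1) Lc) Lc)) κ u) := by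
    intro κ u t
    simp only []
    rw [SymCorrectorFace.slotPsiS_shift (pos_Lc (Lc := Lc)) (ctrOff (d + 1) Lc) (fun κ u t => CombChartStepJets.ScombOf_translate tabs cE cVH cΛ j κ u t) κ u t,
      CombTransportZeroMode.conj_psiKS_shiftK (ctrOff (d + 1) Lc) (pos_Lc (Lc := Lc))]
  simp only []
  rw [SpineRooted.e3OfK_translate (N := Lc) (fun t => AxialDressingRooted.shiftK_coDressKBmAt_KInvStep (d := d) (ctr (d + 1) Lc) j t) hS κ u ((Lc : ℤ) • t)]
  rfl

omit [NeZero Lc] in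
/-- [folklore] **THE LEVEL-0 E-SECTOR `cE • wilsonA` IS BLOCK-COVARIANT** (`wilsonA_translate`). -/
theorem E_zero_translate (cE : ℝ) (κ : Fin (d + 1)) (u t : Site (d + 1)) :
    (fun κ u => cE • wilsonA d κ u) κ (u + (Lc : ℤ) • t) = shiftK (-((Lc : ℤ) • t)) ((fun κ u => cE • wilsonA d κ u) κ u) := by
  simp only []
  rw [wilsonA_translate]
  rfl

omit [NeZero Lc] in
/-- [folklore] **THE BORDER SECTOR `c • tabs.V` IS BLOCK-COVARIANT** ((TV)). -/
theorem VH_translate (tabs : SymTables d Lc) (c : ℝ) (κ : Fin (d + 1)) (u t : Site (d + 1)) :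
    (fun κ u => c • tabs.V κ u) κ (u + (Lc : ℤ) • t) = shiftK (-((Lc : ℤ) • t)) ((fun κ u => c • tabs.V κ u) κ u) := by
  simp only []
  rw [tabs.hVt κ u t]
  rfl

/-- [folklore] **THE TRANSPORT OF A BLOCK-COVARIANT TABLE IS BLOCK-COVARIANT** (d1-leaf-03's `slotPsiS_shift` ⨾ leaf-01 g84's `conj_psiKS_shiftK`), at the comb data. -/
theorem transport_translate_comb {S : Fin (d + 1) → Site (d + 1) → MKer (d + 1) (Fib d)}
    (hS : ∀ (κ : Fin (d + 1)) (u t : Site (d + 1)), S κ (u + (Lc : ℤ) • t) = shiftK (-((Lc : ℤ) • t)) (S κ u)) (κ : Fin (d + 1)) (u t : Site (d + 1)) :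
    (fun κ u => comp (comp (trK (psiKS (ctrOff (d + 1) Lc) Lc)) (slotPsiS (ctrOff (d + 1) Lc) Lc S κ u)) (psiKS (ctrOff (d + 1) Lc) Lc)) κ (u + (Lc : ℤ) • t)
      = shiftK (-((Lc : ℤ) • t)) ((fun κ u => comp (comp (trK (psiKS (ctrOff (d + 1) Lc) Lc)) (slotPsiS (ctrOff (d + 1) Lc) Lc S κ u)) (psiKS (ctrOff (d + 1) Lc) Lc)) κ u) := by
  simp only []
  rw [SymCorrectorFace.slotPsiS_shift (pos_Lc (Lc := Lc)) (ctrOff (d + 1) Lc) hS κ u t, CombTransportZeroMode.conj_psiKS_shiftK (ctrOff (d + 1) Lc) (pos_Lc (Lc := Lc))]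

/-- NOT IN PRINT; OUR BOOKKEEPING ([folklore]; 30's `exists_sector_data_succ` AT THE COMB DATA).  One rate for the level-`(j+1)` sectors: the bm kernel `X̃_{j+1}` decays; `V^E′`, `V^VH′`, `V^M` are
vertex families (an2's `vertexFamily_vertexOfK ∕ vertexFamily_vertexOfM` on the transported sectors' `locStencil_transportPsiS`). -/
theorem exists_sector_data_comb_succ (tabs : SymTables d Lc) (sf sm cE cVH cΛ : ℝ) (j : ℕ)
    {M : Fin (d + 1) → Site (d + 1) → MKer (d + 1) (Fib d)} {CM δM : ℝ} (hM : VertexFamily M Lc CM δM) (hδM : 0 < δM) :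
    ∃ δ CX Cv Cw Cm : ℝ, 0 < δ ∧ Decays (unitK sf sm (coDressKBmAt (ctr (d + 1) Lc) Lc (KInvStep (d := d) Lc (j + 1)))) CX δ ∧
      VertexFamily (vertexOfK (unitK sf sm (coDressKBmAt (ctr (d + 1) Lc) Lc (KInvStep (d := d) Lc (j + 1)))) Lc
        (unitS sf sm (fun κ u => comp (comp (trK (psiKS (ctrOff (d + 1) Lc) Lc)) (slotPsiS (ctrOff (d + 1) Lc) Lc
          (fun κ u => (cE * wE d Lc (j + 1)) • e3OfK Lc (coDressKBmAt (ctr (d + 1) Lc) Lc (KInvStep (d := d) Lc j))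
            (fun κ u => comp (comp (trK (psiKS (ctrOff (d + 1) Lc) Lc)) (slotPsiS (ctrOff (d + 1) Lc) Lc (ScombOf tabs cE cVH cΛ j) κ u)) (psiKS (ctrOff (d + 1) Lc) Lc)) κ u) κ u))
          (psiKS (ctrOff (d + 1) Lc) Lc)))) Lc Cv δ ∧
      VertexFamily (vertexOfK (unitK sf sm (coDressKBmAt (ctr (d + 1) Lc) Lc (KInvStep (d := d) Lc (j + 1)))) Lc
        (unitS sf sm (fun κ u => comp (comp (trK (psiKS (ctrOff (d + 1) Lc) Lc)) (slotPsiS (ctrOff (d + 1) Lc) Lc (fun κ u => (cVH * wVH d Lc (j + 1)) • tabs.V κ u) κ u))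
          (psiKS (ctrOff (d + 1) Lc) Lc)))) Lc Cw δ ∧
      VertexFamily (vertexOfM (unitK sf sm (coDressKBmAt (ctr (d + 1) Lc) Lc (KInvStep (d := d) Lc (j + 1)))) Lc M) Lc Cm δ := by
  obtain ⟨δK, CK, hδK, -, hXd⟩ := decays_coDressKBmAt_KInvStep (d := d) (Lc := Lc) (ctrOff_mem_box (pos_Lc (Lc := Lc))) (j + 1)
  have hXu := decays_unitK (sf := sf) (sm := sm) hXd
  have hCX : 0 ≤ max |sf| |sm| * CK * max |sf| |sm| := hXu.nonneg (Sum.inl 0)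
  have hCM : 0 ≤ CM := (hM 0 0).nonneg (Sum.inl 0)
  obtain ⟨CE, δE, hδE, hE⟩ := exists_locStencil_e3Sector_comb (d := d) (Lc := Lc) tabs cE cVH cΛ j
  obtain ⟨CV, hV⟩ := tabs.hV 1 zero_le_one
  obtain ⟨C₁, δ₁, hδ₁, hT₁⟩ := locStencil_transportPsiS (pos_Lc (Lc := Lc)) (ctrOff_mem_box (pos_Lc (Lc := Lc))) (locStencil_smul (cE * wE d Lc (j + 1)) hE) hδE
  obtain ⟨C₂, δ₂, hδ₂, hT₂⟩ := locStencil_transportPsiS (pos_Lc (Lc := Lc)) (ctrOff_mem_box (pos_Lc (Lc := Lc))) (locStencil_smul (cVH * wVH d Lc (j + 1)) hV) one_pos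
  set m : ℝ := min (min δK δM) (min δ₁ δ₂) with hm
  have hm0 : 0 < m := lt_min (lt_min hδK hδM) (lt_min hδ₁ hδ₂)
  have hX1 : Decays (unitK sf sm (coDressKBmAt (ctr (d + 1) Lc) Lc (KInvStep (d := d) Lc (j + 1)))) (max |sf| |sm| * CK * max |sf| |sm|) m :=
    OneStepResolventKernel.decays_mono hXu hCX le_rfl ((min_le_left _ _).trans (min_le_left _ _))
  have hM1 : VertexFamily M Lc CM m := fun ρ' w => biLoc_mono (hM ρ' w) hCM ((min_le_left _ _).trans (min_le_right _ _))
  have hS1 := BalabanStepJets.locStencil_mono hT₁ ((hT₁ 0 0).nonneg (Sum.inl 0)) ((min_le_right _ _).trans (min_le_left _ _) : m ≤ δ₁)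
  have hS2 := BalabanStepJets.locStencil_mono hT₂ ((hT₂ 0 0).nonneg (Sum.inl 0)) ((min_le_right _ _).trans (min_le_right _ _) : m ≤ δ₂)
  have hVE := vertexFamily_vertexOfK (N := Lc) hX1 hCX (locStencil_unitS (sf := sf) (sm := sm) hS1) hm0 le_rfl
  have hVW := vertexFamily_vertexOfK (N := Lc) hX1 hCX (locStencil_unitS (sf := sf) (sm := sm) hS2) hm0 le_rfl
  have hVM := SecondOrderResponse.vertexFamily_vertexOfM hX1 hCX hM1 hm0 le_rfl
  exact ⟨m / 2, _, _, _, _, half_pos hm0, OneStepResolventKernel.decays_mono hX1 hCX le_rfl (by linarith), hVE, hVW, hVM⟩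

end Comb

end Summit.QuantumFields.BalabanUV.Beta.GAN24.CombForcingSectorSplit

end
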